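/-
Copyright (c) 2026. All rights reserved.
Released under Apache 2.0 license as described in the file LICENSE.
Authors: abc-iut cell, prover seat abc-iut-w5-d053 (gen 5; brick «C-carrier» of abc-iut-w5-d144's COR510iv-SB′ closer spec v2,
abc-iut-L4-lead m136), over abc-iut-L4-t5's generic `TS`-observable construction (`LogFrobeniusObservablesTSOfIotaSquare.lean`),
abc-iut-f-101's `⊞` construction, and this seat's transport file `LogFrobeniusMonoGenuineSubHolomorphicOver.lean`.
-/
import Literature.AnabelianGeometry.AbsoluteAnabelian.LogFrobeniusObservablesTSOfIotaSquare
import Literature.AnabelianGeometry.AbsoluteAnabelian.LogFrobeniusMonoGenuineSubHolomorphicOver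
import HarnessLib

/-!
# [AbsTopIII] Cor 5.5 (iii), BOTH halves, at the genuine OPEN-AUGMENTATION carrier (and at every open-augmentation sub-model):
# the observables `S_log⊞_v` AND `S_log_v` exist there, for EVERY `TS`-datum — brick C of the Cor 5.10 (iv) s_b′ closer at the carrier

S. Mochizuki, *Topics in absolute anabelian geometry III*, J. Math. Sci. Univ. Tokyo 22 (2015) [MochizukiAbsTopIII2015]; locators =
kurims manuscript pages (`paper:url-5493eb38cbb7`): Cor 5.5 (iii) p. 131 l. 29–62 («… a structure of observable S_log⊞ (respectively,
S_log) on …»), Def 5.4 (iii) p. 126 (the commuting square of `Γ⃗^log_non`), Cor 5.10 (iv)(b) pp. 147–148.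

## What this file proves (PROOF-ONLY; MODEL-LEVEL; no def, no Prop fact)

abc-iut-L4-t5's generic construction (row «COR55iii-TS-OBSERVABLE-GENERIC», 2026-08-27) gives, over the interface, the
`TS`-valued observable `S_log_v` of Cor 5.5 (iii) wherever the `⊞`-valued one exists, for EVERY `TS`-datum
(`cor55ObservablesTS_of_cor55Observables`; located form `exists_isLogObservableTS_iff … ↔ IotaSquaresCommuteTS T v`), with model
instances at `nonarchGenuine`, `nonarchGenuineMono`, `nonarchGenuineOver`, `nonarchGenuineSlim` (`LogFrobeniusObservablesTSGenuine.lean`).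
At this seat's open-augmentation SUB-MODEL settings the `⊞` side holds (`nonarchGenuineMonoAnSub_cor55Observables`, transported from
abc-iut-w6-d028's over-`ι` theorem, `LogFrobeniusMonoGenuineSubHolomorphicOver.lean`).  Hence, at EVERY sub-model carrier
`nonarchGenuineMonoAnSub p P ψ` and in particular at abc-iut-f-101's `genuineOpen p Vmod` (the carrier of
`cor510MonoTelecorePinned_genuineOpen`, all places nonarchimedean):

* ★ `nonarchGenuineMonoAnSub_iotaSquaresCommuteTS` / ★ `genuineOpen_iotaSquaresCommuteTS` — abc-iut-L4-t5's `TS` ι-diamond law at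
  every place, for every `TS`-datum;
* ★ `nonarchGenuineMonoAnSub_cor55ObservablesTS` / ★ `genuineOpen_cor55ObservablesTS` — FACT-LIST F-3080 `Cor55ObservablesTS T`
  HOLDS for EVERY `TS`-datum `T` (in particular for the carriers' own data: `…_self`, with `genuineOpenTS` of
  `LogFrobeniusMonoGenuineIotaOverTS.lean`);
* ★ `genuineOpen_cor55Observables_and_TS` — Cor 5.5 (iii), both halves, at the open carrier;
* `genuineOpen_isLogObservable_pair v T` — the PAIR of observable families at `v` that bricks D2 / E consume: `Hplus v :=`
  abc-iut-f-101's `logObsFamily v hsq` (an `S_log⊞_v`) and `Hts v :=` abc-iut-L4-t5's `logObsFamilyTS v T hsqTS` (an `S_log_v`),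
  `hsq := genuineOpen_iotaSquaresCommute`, `hsqTS := genuineOpen_iotaSquaresCommuteTS`.

(The forget-PUSHFORWARD of `Hplus v` as a family on the `TS`-diagram is this seat's `pushFamily (Hplus v)` of
`LogFrobeniusObservablesTSOfPlus.lean`, with the pushforward property by construction — `PushPair.ofMem`, `pushFamily_η_app_heq`.)

HONEST FRAMING: MODEL-LEVEL instances of interface theorems; refereed pre-IUT material; nothing here bears on [IUTchIII] Cor. 3.12;
no side taken; typed ≠ proved; instantiated ≠ endorsed.
-/

set_option autoImplicit false

open CategoryTheory

namespace Literature.AnabelianGeometry.AbsoluteAnabelian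

namespace LogFrobeniusSetting

open AbsTopIII

variable (p : ℕ) [Fact p.Prime] (P : ObjectProperty (TFModel p))
  (ψ : (b : Bool) → LogVertex b → (MLFClosure.AnMono ⥤ MLFClosure.MonoBase × TSObj)) (Vmod : Type 1) (isArc : Vmod → Bool)

/-! ## §1. At every open-augmentation sub-model carrier -/

/-- ★ abc-iut-L4-t5's `TS` ι-diamond law holds at every sub-model carrier, every place, every `TS`-datum (from the `⊞`-squares,
`iotaSquaresCommuteTS_of_iotaSquaresCommute`). [cite: MochizukiAbsTopIII2015, Definition 5.4 (iii) p.126] -/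
theorem nonarchGenuineMonoAnSub_iotaSquaresCommuteTS (T : (nonarchGenuineMonoAnSub p P ψ Vmod isArc).TSHomotopies) (v : Vmod) :
    (nonarchGenuineMonoAnSub p P ψ Vmod isArc).IotaSquaresCommuteTS T v :=
  (nonarchGenuineMonoAnSub p P ψ Vmod isArc).iotaSquaresCommuteTS_of_iotaSquaresCommute v T
    (nonarchGenuineMonoAnSub_iotaSquaresCommute p P ψ Vmod isArc v)

/-- ★ **F-3080 `Cor55ObservablesTS T` HOLDS at every sub-model carrier, for EVERY `TS`-datum `T`.**
[cite: MochizukiAbsTopIII2015, Cor 5.5 (iii) p. 131] -/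
theorem nonarchGenuineMonoAnSub_cor55ObservablesTS (T : (nonarchGenuineMonoAnSub p P ψ Vmod isArc).TSHomotopies) :
    (nonarchGenuineMonoAnSub p P ψ Vmod isArc).Cor55ObservablesTS T :=
  (nonarchGenuineMonoAnSub p P ψ Vmod isArc).cor55ObservablesTS_of_cor55Observables T
    (nonarchGenuineMonoAnSub_cor55Observables p P ψ Vmod isArc)

/-- … in particular for the carrier's own `TS`-datum `nonarchGenuineMonoAnSubTS`. [cite: MochizukiAbsTopIII2015, Cor 5.5 (iii) p. 131] -/
theorem nonarchGenuineMonoAnSub_cor55ObservablesTS_self :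
    (nonarchGenuineMonoAnSub p P ψ Vmod isArc).Cor55ObservablesTS (nonarchGenuineMonoAnSubTS p P ψ Vmod isArc) :=
  nonarchGenuineMonoAnSub_cor55ObservablesTS p P ψ Vmod isArc _

/-! ## §2. At abc-iut-f-101's `genuineOpen p Vmod` -/

/-- ★ The `TS` ι-diamond law at the genuine open-augmentation carrier, every place, every `TS`-datum.
[cite: MochizukiAbsTopIII2015, Definition 5.4 (iii) p.126] -/
theorem genuineOpen_iotaSquaresCommuteTS (T : (genuineOpen p Vmod).TSHomotopies) (v : Vmod) :
    (genuineOpen p Vmod).IotaSquaresCommuteTS T v :=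
  (genuineOpen p Vmod).iotaSquaresCommuteTS_of_iotaSquaresCommute v T (genuineOpen_iotaSquaresCommute p Vmod v)

/-- ★ **F-3080 `Cor55ObservablesTS T` HOLDS at the genuine open-augmentation carrier for EVERY `TS`-datum `T`.**
[cite: MochizukiAbsTopIII2015, Cor 5.5 (iii) p. 131] -/
theorem genuineOpen_cor55ObservablesTS (T : (genuineOpen p Vmod).TSHomotopies) : (genuineOpen p Vmod).Cor55ObservablesTS T :=
  (genuineOpen p Vmod).cor55ObservablesTS_of_cor55Observables T (genuineOpen_cor55Observables p Vmod)

/-- … in particular for its own `TS`-datum `genuineOpenTS`. [cite: MochizukiAbsTopIII2015, Cor 5.5 (iii) p. 131] -/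
theorem genuineOpen_cor55ObservablesTS_self : (genuineOpen p Vmod).Cor55ObservablesTS (genuineOpenTS p Vmod) :=
  genuineOpen_cor55ObservablesTS p Vmod _

/-- ★ **Cor 5.5 (iii), BOTH halves, at the genuine open-augmentation carrier** (F-3081 ∧ F-3080, every `TS`-datum).
[cite: MochizukiAbsTopIII2015, Cor 5.5 (iii) p. 131] -/
theorem genuineOpen_cor55Observables_and_TS (T : (genuineOpen p Vmod).TSHomotopies) :
    (genuineOpen p Vmod).Cor55Observables ∧ (genuineOpen p Vmod).Cor55ObservablesTS T :=
  ⟨genuineOpen_cor55Observables p Vmod, genuineOpen_cor55ObservablesTS p Vmod T⟩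

/-- **The pair of observable families at a place `v` of the open carrier that the s_b′ closer consumes**: `Hplus v :=`
abc-iut-f-101's `logObsFamily v hsq` is an `S_log⊞_v` and `Hts v :=` abc-iut-L4-t5's `logObsFamilyTS v T hsqTS` is an `S_log_v`.
[cite: MochizukiAbsTopIII2015, Cor 5.10 (iv)(b) pp. 147–148] -/
theorem genuineOpen_isLogObservable_pair (T : (genuineOpen p Vmod).TSHomotopies) (v : Vmod) :
    (genuineOpen p Vmod).IsLogObservablePlus v
        ((genuineOpen p Vmod).logObsFamily v (genuineOpen_iotaSquaresCommute p Vmod v)) ∧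
      (genuineOpen p Vmod).IsLogObservableTS T v
        ((genuineOpen p Vmod).logObsFamilyTS v T (genuineOpen_iotaSquaresCommuteTS p Vmod T v)) :=
  ⟨(genuineOpen p Vmod).isLogObservablePlus_logObsFamily v (genuineOpen_iotaSquaresCommute p Vmod v),
    (genuineOpen p Vmod).isLogObservableTS_logObsFamilyTS v T (genuineOpen_iotaSquaresCommuteTS p Vmod T v)⟩

end LogFrobeniusSetting

end Literature.AnabelianGeometry.AbsoluteAnabelian
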